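import Mathlib
import Literature.MathematicalPhysics.QuantumFieldTheory.Balaban1983to89.B6Prop23KernelInput

/-!
# `Balaban1983to89.B6Prop23TwoSite` — the assembled Proposition 2.3 (`prop23_assembled_rw`) is NOT an implication from
False: a two-site, two-cube consistency model of its whole hypothesis package

B6 = T. Bałaban, *Propagators and renormalization transformations for lattice gauge theories. II*, Commun. Math. Phys.
**96**, 223–250 (1984) [Balaban1984PropagatorsII].

CITATION HEADER (lean-in-tree rule 2026-08-18).  Cell `pub-balaban`, unit `b2b-balaban-b06-g12` (paper sub-cell B06,
gen 12).  Imports: Mathlib + `…B6Prop23KernelInput` (p184899); nothing landed is modified.  Source: doi:10.1007/bf01240221,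
held `paper:balaban1984-cmp96-propagators-rt-ii`; journal page = PDF page + 222.  Cell rows GAPS C-b06g12-9, DIVERGENCE
D-b06.30; journal claim PROP23-TWO-SITE-MODEL.  This module quotes nothing new from the paper: it is a CONSISTENCY
CERTIFICATE for the hypothesis package under which the lineage's headline theorem — Proposition 2.3 p. 238, *"An inverse
of the operator Q′G′²Q′* is given by the convergent expansion (Q′G′²Q′*)^{−1} = C(I − R)^{−1} = Σ_{n=0}^∞ CRⁿ (2.86) and it
satisfies the estimate |(Q′G′²Q′*)^{−1}(y, y′)| ≤ O(1)(L^jη)^{−4}(L^{j′}η)^{−d}e^{−½δ₁d(y,y′)} y, y′ ∈ 𝔅, y ∈ Λ_j, y′ ∈ Λ_{j′}.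
(2.87)"* — is certified (`B6Prop23KernelInput.prop23_assembled_rw`: 62 located hypotheses (+ 3 data, 24 named implicit
parameters) ⟹ (2.86)–(2.87) with every constant explicit; the typed rate of (2.87) is ½δ₁ with δ₁ a free rate name).
(v1.1: docstrings only — the (2.87) quotation corrected to the verbatim print (v1 carried the rate name δ₂ of (2.88) and
dropped «y, y′ ∈ 𝔅»), the hypothesis census made exact, the declaration census 2 defs + 28 theorems; XREAD
`HOME/b2b-balaban-pv09-g7/XREAD-B6Prop23TwoSite-v1.md` R1–R3; every declaration byte-identical to v1 p184976.)

WHY TWO SITES (the honest-scope lines of GAPS C-b06g12-7 and C-b06g12-8).  The one-point model of `B6Prop23Assembled.ptGeo_nonvacuous`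
cannot serve the re-assembled theorem: the change-of-domain rate needs c₃ > 0, the depth comparison `c₃M ≤ δ₀M₀` then
forces M₀ > 0, and the cut-off geometry (□_i and supp h_i at distance ≥ M₀ from the non-empty zone N_i where χ_i varies,
together with Σ_i h_i² = 1) forces a site outside every zone — two sites and two cubes at least.

THE MODEL (`twoGeo`): 𝔅 = {a, b} (`Bool`) at scale 0, d(a, b) = 1000, d(a, a) = 0, L = η = M = 1, R = 0; blocks =
sites (fine lattice = 𝔅, `blk = id`); two cubes indexed by 𝔅 itself: □_i = h_i = 1_{{i}} (`ind`), zone N_i = {the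
other site}, cut-offs χ_i ≡ 1, G′ = D_i = G′(□̃_i) = 1, Q′ = Q′* = id, X = X̃_i = the unit kernel, C_i = diag(□_i);
constants K ≡ 2 (the (2.61) profile of two points), B₁ = c_Q = c_{Q*} = B_C = 1, θ = 0, δ = 1, (δ₀, α′) = (1, 0) for
(2.60), δ₁ = σ = 0, c_σ = c = 2, s = 1/1000, m_g = M₀ = 1000, c₃ = 1000/3 > 0, n₀ = 1, so the assembled rate is
(δ − α′δ₀)/3 = 1/3, B_X = 2, B_D = C_tot = 2, K of (2.85) = 156/(1000e) and «M large» reads 624/(1000e) ≤ 1.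

WHAT THIS MODULE PROVES (kernel-checked; no `sorry`, no axiom beyond Lean's three):
1. the model data and their elementary properties (`twoGeo_pseudo`, `chain_one_two`, `kerOp_ind`, `kerOp_diag`,
   `h270_two`, `hasMajorant_one_two`, `hasMajorantHom_id_two`, `sum_exp_le_two`, `K285_two`, `threshold_two`, …);
2. `twoSite_nonvacuous` — **`prop23_assembled_rw` APPLIED ON THE MODEL WITH EVERY HYPOTHESIS DISCHARGED** (the `obtain`
   line is the theorem instantiated there), yielding: the unit kernel on {a, b} has a two-sided inverse G in the pairing
   (2.69) of the form (2.86), unique, with |G(y, y′)(L^{j′}η)^{−d}| ≤ 4.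
So the 62 hypotheses of the assembled Proposition 2.3 — cut algebra, block majorants, zone majorants, Q′-data, the C_□
data (2.81)/(2.70), the partition data (2.36), (2.60), the (2.61) profile, `Ineq261With`/`Ineq263With`, the thresholds
and the depth comparison — are SIMULTANEOUSLY SATISFIABLE with c₃ > 0, M₀ > 0 and a genuine two-cube partition.
WHAT IT DOES NOT SHOW: that the paper's actual objects satisfy them (that is the content of Sect. 2, located as
hypotheses throughout the lineage); nothing about (2.87)'s sharpness.  Value = consistency certificate, NOT summit progress.
-/

namespace Literature.MathematicalPhysics.QuantumFieldTheory.Balaban1983to89.B6Prop23TwoSite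

open Finset Real
open B4Sect5Torus (IsPseudoDist)
open B6DomainChange (Profile)
open B6RandomWalk (HasMajorant BlockSupp Ineq260)
open B6RandomWalkHom (HasMajorantHom)
open B6DomainMajorant (Ctot eps1)
open B6Expansion282 (kerOp kerOp_apply locOp Cglued R282)
open B6Prop23Chain (mat)
open B6Lemma21Repaired (Ineq261With Ineq263With)
open B6Ineq268 (LevelSep mx)
open B6Prop23Assembled (K285 kappa2 kappa3 kappa4)
open B6Prop23KernelInput (prop23_assembled_rw)

/-! ## §1  The two-site carrier -/

/-- 𝔅 = {a, b} at scale 0, d(a, b) = 1000, η = L = M = 1, R = 0 (a consistency model only). [folklore] -/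
@[reducible] noncomputable def twoGeo : B6.Geometry where
  Site := Bool
  fin := inferInstance
  scale := fun _ => 0
  dist := fun a b => if a = b then 0 else 1000
  k := 0
  eta := 1
  L := 1
  R := 0
  M := 1
  Hyp21_22 := True
  Loc := PUnit
  suppIn := fun _ _ => True
  supNorm := fun _ => 0
  l2Norm := fun _ => 0
  holder := fun _ _ => 0
  Cut := PUnit
  cutIn := fun _ _ => True
  cutH := fun _ _ => 0
  cutSup := fun _ => 0

/-- Unfolding: the distance. [folklore] -/
@[simp] theorem twoGeo_dist (a b : twoGeo.Site) : twoGeo.dist a b = if a = b then 0 else 1000 := rfl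

/-- Unfolding: the scale is 0. [folklore] -/
@[simp] theorem twoGeo_scale (a : twoGeo.Site) : twoGeo.scale a = 0 := rfl

/-- Unfolding: L = 1. [folklore] -/
@[simp] theorem twoGeo_L : twoGeo.L = 1 := rfl

/-- Unfolding: M = 1. [folklore] -/
@[simp] theorem twoGeo_M : twoGeo.M = 1 := rfl

/-- Unfolding: R = 0. [folklore] -/
@[simp] theorem twoGeo_R : twoGeo.R = 0 := rfl

/-- Unfolding: η = 1. [folklore] -/
@[simp] theorem twoGeo_eta : twoGeo.eta = 1 := rfl

/-- L^jη = 1. [folklore] -/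
@[simp] theorem twoGeo_len (a : twoGeo.Site) : twoGeo.len a = 1 := by simp [B6.Geometry.len]

/-- d ≥ 0. [folklore] -/
theorem twoGeo_dist_nonneg (a b : twoGeo.Site) : 0 ≤ twoGeo.dist a b := by
  by_cases h : a = b <;> simp [h]

/-- d ≤ 1000. [folklore] -/
theorem twoGeo_dist_le (a b : twoGeo.Site) : twoGeo.dist a b ≤ 1000 := by
  by_cases h : a = b <;> simp [h]

/-- d(a, b) = 1000 for a ≠ b. [folklore] -/
theorem twoGeo_dist_ne {a b : twoGeo.Site} (h : a ≠ b) : twoGeo.dist a b = 1000 := by simp [h]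

/-- (2.54), symmetry, d(y, y) = 0: d is a pseudo-distance. [folklore] -/
theorem twoGeo_pseudo : IsPseudoDist twoGeo.dist where
  symm a b := by
    by_cases h : a = b
    · subst h; rfl
    · rw [twoGeo_dist_ne h, twoGeo_dist_ne (Ne.symm h)]
  zero a := by simp
  triangle a b c := by
    by_cases hab : a = b
    · subst hab; simp
    · rw [twoGeo_dist_ne hab]
      have h1 := twoGeo_dist_le a c
      have h2 := twoGeo_dist_nonneg b c
      linarith

/-- The (2.61)-type sums on two points: Σ_{y′} e^{−a d(y,y′)} = 1 + e^{−1000a} ≤ 2 for a ≥ 0 (serves the profile, `Ineq261With`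
at every rate). [folklore] -/
theorem sum_exp_le_two (a : ℝ) (ha : 0 ≤ a) (s : twoGeo.Site) :
    ∑ j : twoGeo.Site, Real.exp (-(a * twoGeo.dist s j)) ≤ 2 := by
  have h1 : Real.exp (-(a * 1000)) ≤ 1 := Real.exp_le_one_iff.mpr (by nlinarith)
  rw [Fintype.sum_bool]
  cases s <;> simp <;> linarith

/-- Chains of unit weights on two points: 2^m. [folklore] -/
theorem chain_one_two (m : ℕ) (y y' : twoGeo.Site) :
    B6RandomWalk.chain (fun _ _ : twoGeo.Site => (1 : ℝ)) m y y' = 2 ^ m := by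
  induction m generalizing y with
  | zero => simp
  | succ m ih => rw [B6RandomWalk.chain_succ, Fintype.sum_bool, ih, ih]; ring

/-! ## §2  Cubes, partition of unity, kernels: the indicator `ind` -/

/-- 1_{{i}}(y): the cube □_i, the partition function h_i and the unit kernel. [folklore] -/
noncomputable def ind (i y : Bool) : ℝ := if i = y then 1 else 0

/-- ind i i = 1. [folklore] -/
@[simp] theorem ind_self (i : Bool) : ind i i = 1 := by simp [ind]

/-- ind i y = 0 for i ≠ y. [folklore] -/
theorem ind_ne {i y : Bool} (h : i ≠ y) : ind i y = 0 := by simp [ind, h]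

/-- ind ∈ {0, 1}. [folklore] -/
theorem ind_zero_or_one (i y : Bool) : ind i y = 0 ∨ ind i y = 1 := by
  by_cases h : i = y <;> simp [ind, h]

/-- ind i y ≠ 0 ↔ i = y. [folklore] -/
theorem ind_ne_zero_iff {i y : Bool} : ind i y ≠ 0 ↔ i = y := by
  by_cases h : i = y <;> simp [ind, h]

/-- ind² = ind. [folklore] -/
theorem ind_mul_self (i y : Bool) : ind i y * ind i y = ind i y := by
  rcases ind_zero_or_one i y with h | h <;> simp [h]

/-- |ind| ≤ 1. [folklore] -/
theorem abs_ind_le (i y : Bool) : |ind i y| ≤ 1 := by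
  rcases ind_zero_or_one i y with h | h <;> simp [h]

/-- The unit kernel is the identity operator in the pairing (2.69) (weights (L^jη)^d = 1). [folklore] -/
theorem kerOp_ind (d : ℕ) :
    kerOp (fun z => twoGeo.len z ^ d) (fun y y' : twoGeo.Site => ind y y') = 1 := by
  refine LinearMap.ext fun μ => funext fun u => ?_
  rw [kerOp_apply, Fintype.sum_bool]
  cases u <;> simp [ind]

/-- C_i = diag(□_i): its kernel operator is multiplication by □_i. [folklore] -/
theorem kerOp_diag (d : ℕ) (i : Bool) :
    kerOp (fun z => twoGeo.len z ^ d) (fun y'' y' : twoGeo.Site => ind i y'' * ind y'' y') =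
      B6Expansion282.mulOp (ind i) := by
  refine LinearMap.ext fun μ => funext fun u => ?_
  rw [kerOp_apply, Fintype.sum_bool, B6Expansion282.mulOp_apply]
  cases u <;> simp [ind]

/-- (2.70) on the model: □_i X̃_i □_i · C_i · h_i = h_i (□_i = h_i = 1_{{i}}, X̃_i = unit kernel, C_i = diag □_i). [folklore] -/
theorem h270_two (d : ℕ) (i : Bool) :
    locOp (fun i => B6Expansion282.mulOp (ind i)) (fun _ => kerOp (fun z => twoGeo.len z ^ d)
        (fun y y' : twoGeo.Site => ind y y')) i *
      kerOp (fun z => twoGeo.len z ^ d) (fun y'' y' : twoGeo.Site => ind i y'' * ind y'' y') *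
      B6Expansion282.mulOp (ind i) = B6Expansion282.mulOp (ind i) := by
  rw [kerOp_diag]
  unfold locOp
  rw [kerOp_ind, mul_one]
  refine LinearMap.ext fun μ => funext fun u => ?_
  simp only [Module.End.mul_apply, B6Expansion282.mulOp_apply]
  rcases ind_zero_or_one i u with h | h <;> simp [h]

/-! ## §3  Majorants of the model operators -/

/-- The identity has the (2.67)₁-type block majorant B₁(L^jη)²e^{−δd} with B₁ = δ = 1 (blocks = sites). [folklore] -/
theorem hasMajorant_one_two :
    HasMajorant (fun u : twoGeo.Site => u) (1 : Module.End ℝ (twoGeo.Site → ℝ))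
      (fun a b => 1 * twoGeo.len a ^ 2 * Real.exp (-(1 * twoGeo.dist a b))) := by
  intro y' μ B hμ x
  show |μ x| ≤ _
  by_cases hx : x = y'
  · subst hx
    simpa using hμ.bound x rfl
  · rw [hμ.off x hx, abs_zero]
    have := hμ.nonneg
    positivity

/-- The identity, as a two-space operator, has the majorant 1·1_{a=b} (Q′ = Q′* = id, c_Q = c_{Q*} = 1). [folklore] -/
theorem hasMajorantHom_id_two :
    HasMajorantHom (fun u : twoGeo.Site => u) (fun u : twoGeo.Site => u)
      (LinearMap.id : (twoGeo.Site → ℝ) →ₗ[ℝ] (twoGeo.Site → ℝ))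
      (fun (a b : twoGeo.Site) => 1 * (if a = b then (1 : ℝ) else 0)) := by
  intro y' μ B hμ v
  show |μ v| ≤ _
  by_cases hv : v = y'
  · subst hv
    simpa using hμ.bound v rfl
  · rw [hμ.off v hv, abs_zero]
    simp [hv]

/-- The commutator products vanish (χ ≡ 1): the zone majorant with θ = 0. [folklore] -/
theorem hasMajorant_comm_two (N : Finset twoGeo.Site) (T : Module.End ℝ (twoGeo.Site → ℝ)) :
    HasMajorant (fun u : twoGeo.Site => u)
      ((B9Thm37Sum.mulOp (fun _ : twoGeo.Site => (1 : ℝ)) * 1 - 1 * B9Thm37Sum.mulOp (fun _ : twoGeo.Site => (1 : ℝ))) * T)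
      (fun a b => (if a ∈ N then (0 : ℝ) else 0) * Real.exp (-(1 * twoGeo.dist a b))) := by
  intro y' μ B hμ x
  simp

/-! ## §4  The constant of (2.85) and «M large» on the model -/

/-- K of (2.85) on the model: K = 156/(1000e). [folklore] -/
theorem K285_two (d : ℕ) :
    K285 twoGeo d 1 (1 / 1000) ((1 - 0 * 1) / 3) 2 (1000 / 3) 1000 (1 * 1 * ((1 : ℝ) ^ 2 * (twoGeo.L ^ 2 * 2)))
      (1 * 1 * (twoGeo.L ^ 2 * Ctot (fun _ => (2 : ℝ)) 1 0 (1 - 0 * 1))) 1 = 156 / (1000 * Real.exp 1) := by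
  unfold K285 kappa2 kappa3 kappa4 Ctot eps1
  simp only [one_pow, mul_one, one_mul]
  have he : Real.exp 1 ≠ 0 := Real.exp_ne_zero 1
  field_simp
  ring

/-- «M large» on the model: 2K·c = 624/(1000e) ≤ 1 = M. [folklore] -/
theorem threshold_two (d : ℕ) :
    2 * K285 twoGeo d 1 (1 / 1000) ((1 - 0 * 1) / 3) 2 (1000 / 3) 1000 (1 * 1 * ((1 : ℝ) ^ 2 * (twoGeo.L ^ 2 * 2)))
      (1 * 1 * (twoGeo.L ^ 2 * Ctot (fun _ => (2 : ℝ)) 1 0 (1 - 0 * 1))) 1 * 2 ≤ twoGeo.M := by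
  rw [K285_two, twoGeo_M]
  have he1 : 1 ≤ Real.exp 1 := Real.one_le_exp (by norm_num)
  have hpos : 0 < Real.exp 1 := Real.exp_pos 1
  rw [show (2 : ℝ) * (156 / (1000 * Real.exp 1)) * 2 = 624 / 1000 * (Real.exp 1)⁻¹ by field_simp; ring]
  have hinv : (Real.exp 1)⁻¹ ≤ 1 := inv_le_one_of_one_le₀ he1
  nlinarith

/-! ## §5  The theorem applied: every hypothesis discharged -/

/-- **NON-VACUITY OF THE ASSEMBLED PROPOSITION 2.3** (`B6Prop23KernelInput.prop23_assembled_rw`, hence of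
`B6Prop23DomainInput.prop23_assembled_fine` and `B6Prop23Assembled.prop23_assembled` with their kernel inputs derived):
all 62 hypotheses hold simultaneously on the two-site, two-cube model (module docstring) — the `obtain` line is the
theorem applied there with every hypothesis discharged; what it yields: the unit kernel on {a, b} has the inverse G of the
form (2.86) with |G(y, y′)(L^{j′}η)^{−d}| ≤ 4. [folklore] -/
theorem twoSite_nonvacuous (d : ℕ) :
    ∃ Ginv : Module.End ℝ (twoGeo.Site → ℝ),
      Ginv * kerOp (fun z => twoGeo.len z ^ d) (fun y y' : twoGeo.Site => ind y y') = 1 ∧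
      ∀ y y', |mat Ginv y y' / twoGeo.len y' ^ d| ≤ 4 := by
  -- geometry
  have hsep : LevelSep twoGeo := fun y y' => by
    show (0 : ℝ) * 1 * mx twoGeo y y' ≤ twoGeo.dist y y'
    rw [zero_mul, zero_mul]; exact twoGeo_dist_nonneg y y'
  have hL : (1 : ℝ) ≤ twoGeo.L := le_rfl
  have hη : (0 : ℝ) < twoGeo.eta := one_pos
  have hM : (0 : ℝ) < twoGeo.M := one_pos
  have hRM : (0 : ℝ) ≤ twoGeo.R * twoGeo.M := by simp
  have h260 : Ineq260 twoGeo 1 0 := fun y y' => by simp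
  have hK : ∀ a : ℝ, 0 < a → (0 : ℝ) ≤ (fun _ : ℝ => (2 : ℝ)) a := fun _ _ => by norm_num
  have hPr : Profile twoGeo.dist (fun a : twoGeo.Site => a) (fun _ : ℝ => (2 : ℝ)) :=
    fun a ha s => sum_exp_le_two a ha.le s
  have hα' : (0 : ℝ) ≤ 0 * 1 := by norm_num
  have hsize : twoGeo.L ^ 2 * Real.exp (-(0 * 1 * (twoGeo.R * twoGeo.M))) ≤ 1 := by simp
  have hκδ : (0 : ℝ) * 1 < 1 := by norm_num
  have hB₁ : (0 : ℝ) ≤ 1 := zero_le_one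
  have hθ : (0 : ℝ) ≤ 0 := le_rfl
  -- constants of the assembled Prop. 2.3
  have hδ₁ : (0 : ℝ) ≤ 0 := le_rfl
  have hsplit : (0 : ℝ) + 0 * ((1 - 0 * 1) / 3) ≤ (1 - 0 * 1) / 3 / 4 := by norm_num
  have h261σ : Ineq261With 2 twoGeo ((1 - 0 * 1) / 3) 0 := fun y => by simp
  have hthr : twoGeo.L ^ 4 ≤ Real.exp (1 / 8 * ((1 - 0 * 1) / 3) * twoGeo.R * twoGeo.M) := by simp
  have h261 : Ineq261With 2 twoGeo 0 (1 / 2) := fun y => by simp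
  have h263 : Ineq263With 2 twoGeo 0 (1 / 2) := fun m y y' => by
    have hw : (fun a b : twoGeo.Site => Real.exp (-(0 * twoGeo.dist a b))) = fun _ _ => 1 := by
      funext a b; simp
    rw [hw, chain_one_two]
    have h2 : (2 : ℝ) ^ m ≤ 2 ^ (m + 1) := pow_le_pow_right₀ (by norm_num) (Nat.le_succ m)
    simpa using h2
  have hc : (0 : ℝ) ≤ 2 := by norm_num
  have hc₃ : (0 : ℝ) < 1000 / 3 := by norm_num
  have hs : (0 : ℝ) ≤ 1 / 1000 := by norm_num
  have hmg : (0 : ℝ) < 1000 := by norm_num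
  have hBC : (0 : ℝ) ≤ 1 := zero_le_one
  -- cubes, partition of unity, kernels
  have hover : ∀ y : twoGeo.Site, (Finset.univ.filter fun i => ind i y ≠ 0).card ≤ 1 := fun y => by
    have hsub : (Finset.univ.filter fun i => ind i y ≠ 0) ⊆ {y} := fun i hi => by
      rw [Finset.mem_filter] at hi
      rw [Finset.mem_singleton]
      exact ind_ne_zero_iff.mp hi.2
    exact (Finset.card_le_card hsub).trans (by simp)
  have hpf01 : ∀ i y : twoGeo.Site, ind i y = 0 ∨ ind i y = 1 := ind_zero_or_one
  have hph : ∀ i y : twoGeo.Site, ind i y * ind i y = ind i y := ind_mul_self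
  have h236 : ∀ y : twoGeo.Site, ∑ i : twoGeo.Site, ind i y ^ 2 = 1 := fun y => by
    rw [Fintype.sum_bool]; cases y <;> simp [ind]
  have hLip : ∀ i y y'' : twoGeo.Site, |ind i y - ind i y''| ≤ 1 / 1000 / twoGeo.M * twoGeo.dist y y'' := by
    intro i y y''
    by_cases h : y = y''
    · subst h; simp
    · rw [twoGeo_dist_ne h, twoGeo_M]
      rcases ind_zero_or_one i y with h1 | h1 <;> rcases ind_zero_or_one i y'' with h2 | h2 <;>
        simp [h1, h2]
  have hcube : ∀ i y : twoGeo.Site, ind i y ≠ 0 → (fun _ : twoGeo.Site => 0) i ≤ twoGeo.scale y ∧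
      twoGeo.scale y ≤ (fun _ : twoGeo.Site => 0) i + 1 := fun _ _ _ => ⟨le_rfl, by simp⟩
  have hlev : ∀ i y y' : twoGeo.Site, ind i y ≠ 0 → ind i y' ≠ 0 → twoGeo.scale y = twoGeo.scale y' :=
    fun _ _ _ _ _ => rfl
  have hgap : ∀ i y y'' : twoGeo.Site, ind i y = 0 → ind i y'' ≠ 0 → 1000 * twoGeo.M ≤ twoGeo.dist y y'' := by
    intro i y y'' h0 h1
    have hiy'' : i = y'' := ind_ne_zero_iff.mp h1
    have hiy : i ≠ y := fun h => by subst h; simp at h0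
    subst hiy''
    rw [twoGeo_dist_ne (Ne.symm hiy), twoGeo_M, mul_one]
  have h281 : ∀ i y y' : twoGeo.Site, ind i y ≠ 0 → ind i y' ≠ 0 →
      |ind i y * ind y y'| ≤ 1 / (twoGeo.L ^ (fun _ : twoGeo.Site => 0) i * twoGeo.eta) ^ (d + 4) *
        Real.exp (-(0 * twoGeo.dist y y')) := by
    intro i y y' h0 h1
    have hiy : i = y := ind_ne_zero_iff.mp h0
    have hiy' : i = y' := ind_ne_zero_iff.mp h1
    subst hiy; subst hiy'
    simp
  have hCk0 : ∀ i y'' y' : twoGeo.Site, ind i y'' = 0 → ind i y'' * ind y'' y' = 0 := fun _ _ _ h => by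
    rw [h, zero_mul]
  have h270 := h270_two d
  -- zones, cut-offs, the fine-lattice operators
  have hN : ∀ i : twoGeo.Site, (({!i} : Finset twoGeo.Site)).Nonempty := fun i => Finset.singleton_nonempty _
  have hχ1 : ∀ (i : twoGeo.Site) (x : twoGeo.Site), |(fun (_ : twoGeo.Site) (_ : twoGeo.Site) => (1 : ℝ)) i x| ≤ 1 :=
    fun _ _ => by simp
  have hpfχ : ∀ (i : twoGeo.Site) (x : twoGeo.Site),
      ind i ((fun u : twoGeo.Site => u) x) * (fun (_ : twoGeo.Site) (_ : twoGeo.Site) => (1 : ℝ)) i x =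
        ind i ((fun u : twoGeo.Site => u) x) := fun _ _ => mul_one _
  have hhχ : ∀ (i : twoGeo.Site) (x : twoGeo.Site),
      (fun (_ : twoGeo.Site) (_ : twoGeo.Site) => (1 : ℝ)) i x * ind i ((fun u : twoGeo.Site => u) x) =
        ind i ((fun u : twoGeo.Site => u) x) := fun _ _ => one_mul _
  have hχN : ∀ (i : twoGeo.Site) (x : twoGeo.Site), (fun u : twoGeo.Site => u) x ∉ ({!i} : Finset twoGeo.Site) →
      (fun (_ : twoGeo.Site) (_ : twoGeo.Site) => (1 : ℝ)) i x = 1 := fun _ _ _ => rfl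
  have hGD : ∀ i : twoGeo.Site, (1 : Module.End ℝ (twoGeo.Site → ℝ)) * (fun _ : twoGeo.Site =>
      (1 : Module.End ℝ (twoGeo.Site → ℝ))) i = 1 := fun _ => mul_one _
  have hχGw : ∀ i : twoGeo.Site, B9Thm37Sum.mulOp ((fun (_ : twoGeo.Site) (_ : twoGeo.Site) => (1 : ℝ)) i) *
      (fun _ : twoGeo.Site => (1 : Module.End ℝ (twoGeo.Site → ℝ))) i *
      (fun _ : twoGeo.Site => (1 : Module.End ℝ (twoGeo.Site → ℝ))) i =
      B9Thm37Sum.mulOp ((fun (_ : twoGeo.Site) (_ : twoGeo.Site) => (1 : ℝ)) i) := fun _ => by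
    rw [mul_one, mul_one]
  have hGwχ : ∀ i : twoGeo.Site, (fun _ : twoGeo.Site => (1 : Module.End ℝ (twoGeo.Site → ℝ))) i *
      (fun _ : twoGeo.Site => (1 : Module.End ℝ (twoGeo.Site → ℝ))) i *
      B9Thm37Sum.mulOp ((fun (_ : twoGeo.Site) (_ : twoGeo.Site) => (1 : ℝ)) i) =
      B9Thm37Sum.mulOp ((fun (_ : twoGeo.Site) (_ : twoGeo.Site) => (1 : ℝ)) i) := fun _ => by
    rw [one_mul, one_mul]
  have hG := hasMajorant_one_two
  have hKG : ∀ i : twoGeo.Site, HasMajorant (fun u : twoGeo.Site => u)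
      ((B9Thm37Sum.mulOp ((fun (_ : twoGeo.Site) (_ : twoGeo.Site) => (1 : ℝ)) i) *
          (fun _ : twoGeo.Site => (1 : Module.End ℝ (twoGeo.Site → ℝ))) i -
        (fun _ : twoGeo.Site => (1 : Module.End ℝ (twoGeo.Site → ℝ))) i *
          B9Thm37Sum.mulOp ((fun (_ : twoGeo.Site) (_ : twoGeo.Site) => (1 : ℝ)) i)) *
        (1 : Module.End ℝ (twoGeo.Site → ℝ)))
      (fun a b => (if a ∈ ({!i} : Finset twoGeo.Site) then (0 : ℝ) else 0) * Real.exp (-(1 * twoGeo.dist a b))) :=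
    fun i => hasMajorant_comm_two {!i} 1
  have hpfdeep : ∀ i y : twoGeo.Site, ind i y ≠ 0 → ∀ n ∈ ({!i} : Finset twoGeo.Site), (1000 : ℝ) ≤ twoGeo.dist y n := by
    intro i y h n hn
    have hiy : i = y := ind_ne_zero_iff.mp h
    subst hiy
    rw [Finset.mem_singleton] at hn
    subst hn
    rw [twoGeo_dist_ne (by cases i <;> decide)]
  have hcQ : (0 : ℝ) ≤ 1 := zero_le_one
  have hQ := hasMajorantHom_id_two
  have hQχ : ∀ i : twoGeo.Site, (B9Thm37Sum.mulOp (ind i) : Module.End ℝ (twoGeo.Site → ℝ)) ∘ₗ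
      (LinearMap.id : (twoGeo.Site → ℝ) →ₗ[ℝ] (twoGeo.Site → ℝ)) =
      (LinearMap.id : (twoGeo.Site → ℝ) →ₗ[ℝ] (twoGeo.Site → ℝ)) ∘ₗ
        (B9Thm37Sum.mulOp (ind i ∘ (fun u : twoGeo.Site => u)) : Module.End ℝ (twoGeo.Site → ℝ)) :=
    fun _ => LinearMap.ext fun _ => rfl
  have hXdef : kerOp (fun z => twoGeo.len z ^ d) (fun y y' : twoGeo.Site => ind y y') =
      (LinearMap.id : (twoGeo.Site → ℝ) →ₗ[ℝ] (twoGeo.Site → ℝ)) ∘ₗ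
        ((1 : Module.End ℝ (twoGeo.Site → ℝ)) * 1) ∘ₗ (LinearMap.id : (twoGeo.Site → ℝ) →ₗ[ℝ] (twoGeo.Site → ℝ)) := by
    rw [kerOp_ind, mul_one]; rfl
  have hM₀ : 1000 / 3 * twoGeo.M ≤ (1 - 0 * 1) / 3 * 1000 := by norm_num
  obtain ⟨G, hGX, -, -, -, hb⟩ :=
    prop23_assembled_rw (g := twoGeo) (X := twoGeo.Site) (ι := twoGeo.Site) d twoGeo_pseudo hsep hL hη hM hRM
      (fun u => u) h260 hK hPr hα' hsize hκδ hB₁ hθ (cσ := 2) (c := 2) (s := 1 / 1000) (mg := 1000) (BC := 1)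
      hδ₁ hsplit h261σ hthr h261 h263 hc hc₃ hs hmg hBC
      (pf := ind) (hf := ind) (js := fun _ => 0) (n₀ := 1) (Xk := fun y y' => ind y y')
      (Xwk := fun _ y y' => ind y y') (Ck := fun i y'' y' => ind i y'' * ind y'' y')
      hover hpf01 hph h236 hLip hcube hlev hgap h281 hCk0 h270 (fun i => {!i}) hN
      (G := 1) (Dop := fun _ => 1) (Gw := fun _ => 1) (χ := fun _ _ => 1)
      hχ1 hpfχ hhχ hχN hGD hGD hχGw hGwχ hG (fun _ => hG) hKG hKG (M₀ := 1000) hpfdeep hpfdeep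
      (Qp := LinearMap.id) (Qs := LinearMap.id) (cQ := 1) (cQs := 1) hcQ hcQ hQ hQ hQχ hQχ hXdef (fun _ => hXdef)
      hM₀ (threshold_two d)
  refine ⟨G, hGX, fun y y' => (hb y y').trans_eq ?_⟩
  simp
  norm_num

end Literature.MathematicalPhysics.QuantumFieldTheory.Balaban1983to89.B6Prop23TwoSite
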